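import Summits.ResolutionOfSingularities.KangarooAtlas.MizutaniFrobeniusGenerization
import HarnessLib

/-!
# Oda's operators `𝒟_e`, `𝒥_e` on the subspaces of `L_e = k^{n+1}`; `𝒥_e𝒟_e((L_B)_e) = (L_B)_e`

Cell `pub-rosobs`, Mizutani enclosure (seat mizutani-encloser-1, gen 9).  AI-written; *AI review is weaker than
expert review*; NOT a resolution-of-singularities theorem (summit relevance C).

H. Mizutani, Nagoya Math. J. 52 (1973), §1 (b): for a subset `V ⊂ L_e` (the additive forms `Σ a_i X_i^{p^e}`,
identified with their coefficient vectors `a ∈ k^{n+1}`) and `i ≤ e`,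
`𝒟_i(V) = Diff_{p^i−1}(k)·V` and `𝒥_i(V) = {f ∈ L_e : Diff_{p^i−1}(k) f ⊆ V}`, the differential operators of `k`
(of order `≤ p^i − 1`, hence over `k^{p^i}`) acting on coefficients (T. Oda, 1973, [O1] §2; Oda 1983-II p. 1169
`𝒟^r`, `𝒥^r`).  Thm. 1.3 (= Oda 1973 Thm. 2.5) characterises the level-`e` invariant forms `N_e = (U(𝔭) ∩ L)_e` of the
Hironaka schemes of exponent `e` by **`𝒥_e𝒟_e(N_e) = N_e`**; Lemma 2.3 (= Oda 1973 Lemma 2.8) is the duality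
`𝒟_e(U)^⊥ = 𝒥_e(U^⊥)`, `𝒥_e(U)^⊥ = 𝒟_e(U^⊥)` for the pairing of `k ⊗_{k^q} W` with `k ⊗_{k^q} W^*`.

This file introduces the two operators at level `e` on `Submodule k (Fin (n+1) → k)` in the tree's vocabulary
(`IsDiffOpLE (frobPow k p e) (p^e − 1)`, exactly the operators quantified over in the DEFINITION of
`invForms`, `Literature/…/HironakaGroupScheme.lean`):

* `dSpan k p e V` (`𝒟_e(V)`: the `k`-span of the `D v`), `jCore k p e U` (`𝒥_e(U) = {a : D a ∈ U ∀ D}`);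
  `gc_dSpan_jCore` — **`𝒟_e(V) ≤ U ↔ V ≤ 𝒥_e(U)`** (a Galois connection; hence `V ≤ 𝒥_e𝒟_e V`, `𝒟_e𝒥_e U ≤ U`,
  `𝒥_e𝒟_e𝒥_e = 𝒥_e`, `𝒟_e𝒥_e𝒟_e = 𝒟_e`, monotonicity), `le_dSpan` (`V ≤ 𝒟_e V`), `jCore_le` (`𝒥_e U ≤ U`);
* **`invForms_eq_jCore_pointForms`** — Oda's definition READ AS `(L_B)_e(𝔭) = 𝒥_e(V_e(𝔭))`, `V_e(𝔭) = pointForms` the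
  additive forms of level `e` in `𝔭`; hence **`jCore_dSpan_invForms : 𝒥_e(𝒟_e((L_B)_e(𝔭))) = (L_B)_e(𝔭)`** for EVERY
  ideal `𝔭` — the necessity of Mizutani's condition (i) of (*) / «`𝒥_e𝒟_e(N_e) = N_e`» of Thm. 1.3 — and
  `dSpan_invForms_le_pointForms` (`𝒟_e((L_B)_e) ⊆ V_e(𝔭)`);
The tensor dictionary (`Σ a_i ⊗ b_i ∈ J^q`) and Mizutani's Lemma 2.3 (`𝒥_e(U^⊥) = 𝒟_e(U)^⊥`, `𝒥_e(U)^⊥ = 𝒟_e(U^⊥)`) are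
`MizutaniOdaDuality.lean`; the sufficiency half of Thm. 1.3 (every proper `𝒥_e𝒟_e`-closed `V` is `(L_B)_e` of a point of
exponent `≤ e`, namely of the `q`-linear point of `𝒟_e(V)`) is `MizutaniHSchemeCriterion.lean`.

## References

* H. Mizutani, *Hironaka's additive group schemes*, Nagoya Math. J. 52 (1973) 85–95: §1 (b), Thm. 1.3, (*) (i), Lemma 2.3.
  [Mizutani1973HironakaGroupSchemes]
* T. Oda, *Hironaka's additive group scheme, II*, Publ. RIMS 19 (1983) 1163–1179: §2, p. 1168 (the display defining
  `(L_B)_e`), p. 1169 (Definition of `𝒟^r(W)`, `𝒥^r(W)`), Thm. 2.2, Cor. 2.3. [Oda1983HironakaGroupSchemeII]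
-/

noncomputable section

open MvPolynomial Literature.AlgebraicGeometry.Resolution
  Literature.AlgebraicGeometry.Resolution.HironakaScheme

namespace Summit.ResolutionOfSingularities.KangarooAtlas.Mizutani

universe u

/-! ## The operators `𝒟_e` and `𝒥_e` -/

section Operators

variable (k : Type u) [Field k] (p : ℕ) [hp : Fact p.Prime] [CharP k p] {n : ℕ} (e : ℕ)

/-- **`𝒟_e(V)`** (Mizutani §1 (b), Oda's `𝒟`): the `k`-span in `k^{n+1}` of the vectors `D v = (D v_0, …, D v_n)` for `v ∈ V`
and `D` a differential operator of `k` over `k^{p^e}` of order `≤ p^e − 1`.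
[cite: Mizutani1973HironakaGroupSchemes, §1 (b) (𝒟_i(V) = Diff_{p^i−1}(k)V)] -/
def dSpan (V : Submodule k (Fin (n + 1) → k)) : Submodule k (Fin (n + 1) → k) :=
  Submodule.span k {w | ∃ v ∈ V, ∃ D : k →ₗ[frobPow k p e] k,
    IsDiffOpLE (frobPow k p e) (p ^ e - 1) D ∧ w = fun i => D (v i)}

/-- **`𝒥_e(U)`** (Mizutani §1 (b), Oda's `𝒥`): the vectors `a ∈ k^{n+1}` all of whose images `D a` under differential
operators `D` of `k/k^{p^e}` of order `≤ p^e − 1` lie in `U` (a `k`-subspace: `D ∘ (c·)` is again such an operator).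
[cite: Mizutani1973HironakaGroupSchemes, §1 (b) (𝒥_i(V) = {f ∈ L_e : Diff_{p^i−1}(k) f ⊆ V})] -/
def jCore (U : Submodule k (Fin (n + 1) → k)) : Submodule k (Fin (n + 1) → k) where
  carrier := {a | ∀ D : k →ₗ[frobPow k p e] k, IsDiffOpLE (frobPow k p e) (p ^ e - 1) D → (fun i => D (a i)) ∈ U}
  zero_mem' := by
    intro D _
    have : (fun i => D ((0 : Fin (n + 1) → k) i)) = 0 := by funext i; simp
    rw [this]; exact U.zero_mem
  add_mem' := by
    intro a b ha hb D hD
    have : (fun i => D ((a + b) i)) = (fun i => D (a i)) + fun i => D (b i) := by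
      funext i; simp [map_add]
    rw [this]; exact U.add_mem (ha D hD) (hb D hD)
  smul_mem' := by
    intro c a ha D hD
    have hD' : IsDiffOpLE (frobPow k p e) (p ^ e - 1) (D ∘ₗ LinearMap.mulLeft (frobPow k p e) c) := by
      have := IsDiffOpLE.comp hD (isDiffOpLE_mulLeft (R := frobPow k p e) (A := k) c)
      simpa using this
    have h := ha _ hD'
    have : (fun i => D ((c • a) i)) = fun i => (D ∘ₗ LinearMap.mulLeft (frobPow k p e) c) (a i) := by
      funext i; simp [LinearMap.mulLeft_apply]
    rw [this]; exact h

variable {e}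

/-- Membership in `𝒥_e(U)`. [cite: Mizutani1973HironakaGroupSchemes, §1 (b)] -/
theorem mem_jCore_iff {U : Submodule k (Fin (n + 1) → k)} {a : Fin (n + 1) → k} :
    a ∈ jCore k p e U ↔
      ∀ D : k →ₗ[frobPow k p e] k, IsDiffOpLE (frobPow k p e) (p ^ e - 1) D → (fun i => D (a i)) ∈ U :=
  Iff.rfl

/-- A generator `D v` of `𝒟_e(V)`. [cite: Mizutani1973HironakaGroupSchemes, §1 (b)] -/
theorem apply_mem_dSpan {V : Submodule k (Fin (n + 1) → k)} {v : Fin (n + 1) → k} (hv : v ∈ V)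
    {D : k →ₗ[frobPow k p e] k} (hD : IsDiffOpLE (frobPow k p e) (p ^ e - 1) D) :
    (fun i => D (v i)) ∈ dSpan k p e V :=
  Submodule.subset_span ⟨v, hv, D, hD, rfl⟩

variable (e)

/-- **The Galois connection `𝒟_e(V) ≤ U ↔ V ≤ 𝒥_e(U)`** (immediate from the definitions).
[cite: Mizutani1973HironakaGroupSchemes, §1 (b) and Lemma 2.3] -/
theorem dSpan_le_iff_le_jCore (V U : Submodule k (Fin (n + 1) → k)) : dSpan k p e V ≤ U ↔ V ≤ jCore k p e U := by
  constructor
  · intro h v hv D hD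
    exact h (apply_mem_dSpan k p hv hD)
  · intro h
    unfold dSpan
    rw [Submodule.span_le]
    rintro _ ⟨v, hv, D, hD, rfl⟩
    exact h hv D hD

/-- `𝒟_e ⊣ 𝒥_e` as a `GaloisConnection` on the lattice of subspaces of `k^{n+1}`. [cite: Mizutani1973HironakaGroupSchemes, §1 (b)] -/
theorem gc_dSpan_jCore : GaloisConnection (dSpan k p e (n := n)) (jCore k p e) :=
  fun V U => dSpan_le_iff_le_jCore k p e V U

/-- `V ≤ 𝒟_e(V)` (the identity is an operator of order `0`). [cite: Mizutani1973HironakaGroupSchemes, §1 (b)] -/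
theorem le_dSpan (V : Submodule k (Fin (n + 1) → k)) : V ≤ dSpan k p e V := by
  intro v hv
  have h := apply_mem_dSpan k p (e := e) hv
    ((isDiffOpLE_id (R := frobPow k p e) (A := k)).of_le (Nat.zero_le _))
  simpa using h

/-- `𝒥_e(U) ≤ U`. [cite: Mizutani1973HironakaGroupSchemes, §1 (b)] -/
theorem jCore_le (U : Submodule k (Fin (n + 1) → k)) : jCore k p e U ≤ U := by
  intro a ha
  have h := ha LinearMap.id ((isDiffOpLE_id (R := frobPow k p e) (A := k)).of_le (Nat.zero_le _))
  simpa using h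

/-- `V ≤ 𝒥_e(𝒟_e(V))`. [cite: Mizutani1973HironakaGroupSchemes, §1 (b)] -/
theorem le_jCore_dSpan (V : Submodule k (Fin (n + 1) → k)) : V ≤ jCore k p e (dSpan k p e V) :=
  (gc_dSpan_jCore k p e).le_u_l V

/-- `𝒟_e(𝒥_e(U)) ≤ U`. [cite: Mizutani1973HironakaGroupSchemes, §1 (b)] -/
theorem dSpan_jCore_le (U : Submodule k (Fin (n + 1) → k)) : dSpan k p e (jCore k p e U) ≤ U :=
  (gc_dSpan_jCore k p e).l_u_le U

/-- `𝒟_e` is monotone. [folklore] -/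
theorem dSpan_mono {V V' : Submodule k (Fin (n + 1) → k)} (h : V ≤ V') : dSpan k p e V ≤ dSpan k p e V' :=
  (gc_dSpan_jCore k p e).monotone_l h

/-- `𝒥_e` is monotone. [folklore] -/
theorem jCore_mono {U U' : Submodule k (Fin (n + 1) → k)} (h : U ≤ U') : jCore k p e U ≤ jCore k p e U' :=
  (gc_dSpan_jCore k p e).monotone_u h

/-- `𝒥_e𝒟_e𝒥_e = 𝒥_e`: every `𝒥_e(U)` is `𝒥_e𝒟_e`-closed. [cite: Mizutani1973HironakaGroupSchemes, Thm. 1.3 (𝒥_e𝒟_e(N_e) = N_e)] -/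
theorem jCore_dSpan_jCore (U : Submodule k (Fin (n + 1) → k)) :
    jCore k p e (dSpan k p e (jCore k p e U)) = jCore k p e U :=
  (gc_dSpan_jCore k p e).u_l_u_eq_u U

/-- `𝒟_e𝒥_e𝒟_e = 𝒟_e`. [cite: Mizutani1973HironakaGroupSchemes, §1 (b)] -/
theorem dSpan_jCore_dSpan (V : Submodule k (Fin (n + 1) → k)) :
    dSpan k p e (jCore k p e (dSpan k p e V)) = dSpan k p e V :=
  (gc_dSpan_jCore k p e).l_u_l_eq_l V

/-- `𝒥_e𝒟_e` is idempotent (a closure operator). [cite: Mizutani1973HironakaGroupSchemes, §1 (b)] -/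
theorem jCore_dSpan_idem (V : Submodule k (Fin (n + 1) → k)) :
    jCore k p e (dSpan k p e (jCore k p e (dSpan k p e V))) = jCore k p e (dSpan k p e V) := by
  rw [dSpan_jCore_dSpan]

/-- `𝒥_e(⊤) = ⊤`. [folklore] -/
theorem jCore_top : jCore k p e (⊤ : Submodule k (Fin (n + 1) → k)) = ⊤ :=
  eq_top_iff.mpr fun _ _ _ _ => Submodule.mem_top

/-- `𝒟_e(⊥) = ⊥`. [folklore] -/
theorem dSpan_bot : dSpan k p e (⊥ : Submodule k (Fin (n + 1) → k)) = ⊥ :=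
  (gc_dSpan_jCore k p e).l_bot

/-- A `𝒥_e𝒟_e`-closed PROPER subspace has proper `𝒟_e`-hull. [folklore] -/
theorem dSpan_ne_top_of_jCore_dSpan_eq {V : Submodule k (Fin (n + 1) → k)} (hV : jCore k p e (dSpan k p e V) = V)
    (hne : V ≠ ⊤) : dSpan k p e V ≠ ⊤ := by
  intro h
  apply hne
  rw [← hV, h, jCore_top]

end Operators

/-! ## Oda's invariant forms are `𝒥_e` of the additive forms through the point -/

section InvForms

variable (k : Type u) [Field k] (p : ℕ) [hp : Fact p.Prime] [CharP k p] {n : ℕ}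
  (𝔭 : Ideal (MvPolynomial (Fin (n + 1)) k)) (e : ℕ)

/-- **`(L_B)_e(𝔭) = 𝒥_e(V_e(𝔭))`**: Oda's printed description of the invariant additive forms, `(L_B)_e = {h ∈ L_e :
D h ∈ 𝔭 ∩ L_e for all D ∈ Diff_{p^e−1}(k/k^{p^e})}`, IS `𝒥_e` of the subspace `V_e(𝔭)` (`pointForms`) of all additive
forms of level `e` in `𝔭`. [cite: Oda1983HironakaGroupSchemeII, §2 (p. 1168, the display) and Cor. 2.3 (V = 𝒥'(U))] -/
theorem invForms_eq_jCore_pointForms : invForms k p 𝔭 e = jCore k p e (pointForms k p 𝔭 e) := by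
  ext a
  rw [mem_invForms_iff, mem_jCore_iff]
  refine forall_congr' fun D => forall_congr' fun _ => ?_
  rw [mem_pointForms_iff]

/-- **`𝒥_e𝒟_e((L_B)_e(𝔭)) = (L_B)_e(𝔭)`** for every ideal `𝔭` and every level `e`: Mizutani's condition (i) of (*) /
«`𝒥_e𝒟_e(N_e) = N_e`» of Thm. 1.3 HOLDS for the invariant forms of every point (necessity; it is `𝒥𝒟𝒥 = 𝒥`).
[cite: Mizutani1973HironakaGroupSchemes, Thm. 1.3 and (*) (i)] -/
theorem jCore_dSpan_invForms : jCore k p e (dSpan k p e (invForms k p 𝔭 e)) = invForms k p 𝔭 e := by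
  rw [invForms_eq_jCore_pointForms, jCore_dSpan_jCore]

/-- `𝒟_e((L_B)_e(𝔭)) ⊆ V_e(𝔭)`: all the `D a`, `a` invariant, are additive forms through the point.
[cite: Oda1983HironakaGroupSchemeII, Cor. 2.3 (proof: U ⊇ 𝒟'(V))] -/
theorem dSpan_invForms_le_pointForms : dSpan k p e (invForms k p 𝔭 e) ≤ pointForms k p 𝔭 e := by
  rw [invForms_eq_jCore_pointForms]
  exact dSpan_jCore_le k p e _

/-- `𝒥_e` of a larger subspace of point forms: if `V_e(𝔭) ≤ U` then `(L_B)_e(𝔭) ≤ 𝒥_e(U)`. [folklore] -/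
theorem invForms_le_jCore_of_pointForms_le {U : Submodule k (Fin (n + 1) → k)} (h : pointForms k p 𝔭 e ≤ U) :
    invForms k p 𝔭 e ≤ jCore k p e U := by
  rw [invForms_eq_jCore_pointForms]
  exact jCore_mono k p e h

end InvForms

end Summit.ResolutionOfSingularities.KangarooAtlas.Mizutani

end
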